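import Summits.AtomisticToContinuum.Crystallization.Theses.MinMeanCycleStackingLock
import Summits.AtomisticToContinuum.Crystallization.Theses.PoissonBesselStacking
import Summits.AtomisticToContinuum.Crystallization.Theses.LuttingerTiszaRegistry
import Summits.AtomisticToContinuum.Crystallization.Theorems.PhononSlackCertificatesPeriodicGivenLayered
import Summits.AtomisticToContinuum.Crystallization.Theorems.MinMeanCycleStackingLockBarlowEnergyIdentification
import Literature.MathematicalPhysics.StatisticalMechanics.HcpHomogeneous

/-!
# `PeriodicReductionToBarlow` (stmt-AtomisticToContinuum-3062) — line `layered-seam`: the reduction theorem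

Support file for the shared crux `MinMeanCycleStackingLock.PeriodicReductionToBarlow` (=
`PoissonBesselStacking.PeriodicReductionToBarlow` = `LuttingerTiszaRegistry.PeriodicReductionToBarlow`):
"every periodic configuration `Q` of `ℝ³` is matched, at no higher Lennard-Jones energy per particle, by a
UNIFORM Barlow stacking with parameters in the box `B = {47/50 ≤ a ≤ 1, 39a/50 ≤ h ≤ 17a/20}`".

Along the line `layered-seam` (`Cruxes/PeriodicReductionToBarlow/Lines/layered_seam.lean`) the crux is cut at
the LAYERED class: `p`-periodic stacks of triangular layers of spacing `a ∈ [47/50, 1]` in hole registry along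
a Hägg word `s`, with FREE interlayer spacings in `[39a/50, 17a/20]`.  This file proves in full everything
of that line except its one genuinely three-dimensional stub, and hence the **reduction**

  `PeriodicReductionToBarlow_of_periodicLayeringInBox :`
  `(every periodic Q is matched by SOME p-periodic layered stacking in the box, word and spacings free)`
  `→ PeriodicReductionToBarlow`.

* `restackAlternating` (word side): at the same heights the alternating word `ABAB…` has layer energy `≤`
  that of any Hägg word, layer by layer — the `c₀ = 0` shadow of `LayeredHull.clo_layer_price` fed with the
  certified registry facts `LayeredHull.stub_registry` and the bookkeeping `LayeredHull.stub_layerCake`.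
* `uniformBarlowFloor` (spacing side + identification): for the alternating word with `p`-periodic
  increments in the box, the uniform stacking at the MEAN increment `h̄` has `2p · e(hcp a h̄) ≤ Σ_{m<p}
  (Φ₀(a) + T_alt(m))`: Jensen with rational weights for MIDPOINT-convex functions (Cauchy induction,
  `jensen_midpoint`, no continuity) applied to the certified `LayeredHull.stub_convexity` of the alternating
  block energies over the `p` cyclic shifts of the increment word; block ↔ period bookkeeping by
  `LayeredHull.clo_block_decomposition` on blocks of `q` periods (boundary error `≤ 16 C` independent of
  `q`, removed by `q → ∞`, Archimedes); identification of the uniform alternating layered stack with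
  `barlowPeriodicConfiguration alternatingHagg` through `stub_layerCake` (clause 3),
  `tsum_points_eq_two_mul_barlowSiteEnergy` and `energyPerParticle_barlow_eq_average`
  (`BarlowEnergyIdentification`, item 3065).
* `PeriodicReductionToBarlow_of` chains layering → restacking → floor and divides by `2p > 0`; the witness
  is `(a, h̄, alternatingHagg, period 2) ∈ B`.

What remains of the crux after this file is exactly the hypothesis of
`PeriodicReductionToBarlow_of_periodicLayeringInBox` (the line's `stub_periodicLayeringInBox`): the
periodic form of the layering half of the crystal problem (Blanc–Lewin 2015, §2.3), implied by the hub
item `LayeredWindows` (stmt-11778) through landed theorems (`Cruxes/PeriodicReductionToBarlow/HullShadow.lean`).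
-/

noncomputable section

namespace Summit.AtomisticToContinuum.Crystallization.Theorems.LayeredSeam

open Finset Literature.MathematicalPhysics.StatisticalMechanics
open Summit.AtomisticToContinuum.Crystallization.Theorems
open Summit.AtomisticToContinuum.Crystallization.Theorems.LayeredHull

local notation "E3" => EuclideanSpace ℝ (Fin 3)

/-- `alternatingHagg (n + 1) = - alternatingHagg n`. -/
theorem alt_succ (n : ℤ) : alternatingHagg (n + 1) = -alternatingHagg n := by
  unfold alternatingHagg
  by_cases hn : Even n
  · have h1 : ¬ Even (n + 1) := by simpa [Int.even_add_one] using hn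
    simp [hn, h1]
  · have h1 : Even (n + 1) := by simpa [Int.even_add_one] using hn
    simp [hn, h1]

/-- For the alternating word the layer interaction at label difference `L m' − L m` depends only on the
parity of `m' − m`. -/
theorem layerInteraction_altLabel (V : ℝ → ℝ) (a H : ℝ) (m' m : ℤ) :
    layerInteraction V a H (haggLabel alternatingHagg m' - haggLabel alternatingHagg m) 1 =
      layerInteraction V a H (if Even (m' - m) then 0 else 1) 1 := by
  rw [haggLabel_alternating, haggLabel_alternating]
  rcases Int.even_or_odd m' with h1 | h1 <;> rcases Int.even_or_odd m with h2 | h2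
  · have : Even (m' - m) := Int.even_sub.2 (by simp [h1, h2])
    simp [h1, h2, this]
  · have h2' : ¬ Even m := Int.not_even_iff_odd.2 h2
    have : ¬ Even (m' - m) := by
      rw [Int.even_sub]; simp [h1, h2']
    simp only [h1, h2', if_true, if_false, this]
    norm_num
    exact layerInteraction_neg_offset V a H 1 1
  · have h1' : ¬ Even m' := Int.not_even_iff_odd.2 h1
    have : ¬ Even (m' - m) := by
      rw [Int.even_sub]; simp [h1', h2]
    simp [h1', h2, this]
  · have h1' : ¬ Even m' := Int.not_even_iff_odd.2 h1
    have h2' : ¬ Even m := Int.not_even_iff_odd.2 h2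
    have : Even (m' - m) := Int.even_sub.2 (by simp [h1', h2'])
    simp [h1', h2', this]

/-- Periodic increments: `z (n + p) − z n` is constant. -/
theorem incr_const (z : ℤ → ℝ) (p : ℕ)
    (hzp : ∀ m : ℤ, z (m + p + 1) - z (m + p) = z (m + 1) - z m) :
    ∀ n : ℤ, z (n + p) - z n = z p - z 0 := by
  intro n
  induction n using Int.induction_on with
  | zero => simp
  | succ k ih =>
    have := hzp k
    have e1 : (k : ℤ) + 1 + p = k + p + 1 := by ring
    rw [e1]
    linarith
  | pred k ih =>
    have := hzp (-(k : ℤ) - 1)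
    have e1 : -(k : ℤ) - 1 + p + 1 = -k + p := by ring
    have e2 : -(k : ℤ) - 1 + 1 = -k := by ring
    rw [e1, e2] at this
    linarith

/-- The alternating-word layer energy at free heights (the `T` of the line). -/
def Tz (a : ℝ) (z : ℤ → ℝ) (m : ℤ) : ℝ :=
  ∑' m' : ℤ, if m' = m then (0 : ℝ) else
    layerInteraction lennardJones a (z m' - z m)
      (haggLabel alternatingHagg m' - haggLabel alternatingHagg m) 1

/-- Parity form of `Tz`. -/
theorem Tz_eq_parity (a : ℝ) (z : ℤ → ℝ) (m : ℤ) :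
    Tz a z m = ∑' m' : ℤ, if m' = m then (0 : ℝ) else
      layerInteraction lennardJones a (z m' - z m) (if Even (m' - m) then 0 else 1) 1 := by
  unfold Tz
  refine tsum_congr fun m' => ?_
  by_cases h : m' = m
  · rw [if_pos h, if_pos h]
  · rw [if_neg h, if_neg h, layerInteraction_altLabel]

/-- `Tz` is `p`-periodic when the increments of `z` are. -/
theorem Tz_periodic (a : ℝ) (z : ℤ → ℝ) (p : ℕ)
    (hzp : ∀ m : ℤ, z (m + p + 1) - z (m + p) = z (m + 1) - z m) (m : ℤ) :
    Tz a z (m + p) = Tz a z m := by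
  rw [Tz_eq_parity, Tz_eq_parity, ← (Equiv.addRight (p : ℤ)).tsum_eq]
  refine tsum_congr fun m' => ?_
  simp only [Equiv.coe_addRight]
  have hc := incr_const z p hzp
  have e1 : z (m' + p) - z (m + p) = z m' - z m := by
    have h1 := hc m'; have h2 := hc m; linarith
  have e2 : m' + (p : ℤ) - (m + p) = m' - m := by ring
  by_cases h : m' = m
  · rw [if_pos (by rw [h]), if_pos h]
  · have h' : m' + (p : ℤ) ≠ m + p := fun hh => h (by linarith)
    rw [if_neg h', if_neg h, e1]
    by_cases hE : Even (m' - m)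
    · have hE' : Even (m' + (p : ℤ) - (m + p)) := by rw [e2]; exact hE
      rw [if_pos hE', if_pos hE]
    · have hE' : ¬ Even (m' + (p : ℤ) - (m + p)) := by rw [e2]; exact hE
      rw [if_neg hE', if_neg hE]

/-- A full-period sum of a `p`-periodic function is shift invariant (natural shifts). -/
theorem sum_range_add_of_periodic {f : ℤ → ℝ} {p : ℕ} (hf : ∀ m, f (m + p) = f m) :
    ∀ j : ℕ, ∑ i ∈ range p, f ((j : ℤ) + i) = ∑ i ∈ range p, f i := by
  intro j
  induction j with
  | zero => simp
  | succ j ih =>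
    have hg : ∀ m : ℤ, f ((j : ℤ) + (m + p)) = f ((j : ℤ) + m) := by
      intro m; rw [← add_assoc, hf]
    have h1 := sum_range_shift_of_periodic (f := fun x : ℤ => f ((j : ℤ) + x)) (n := p) hg
    rw [← ih, ← h1]
    refine sum_congr rfl fun i _ => ?_
    congr 1; push_cast; ring

/-- Sum over `q` periods. -/
theorem sum_range_mul_of_periodic {f : ℤ → ℝ} {p : ℕ} (hf : ∀ m, f (m + p) = f m) (j : ℕ) :
    ∀ q : ℕ, ∑ i ∈ range (q * p), f ((j : ℤ) + i) = (q : ℝ) * ∑ i ∈ range p, f i := by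
  intro q
  induction q with
  | zero => simp
  | succ q ih =>
    rw [Nat.succ_mul, sum_range_add, ih]
    have h2 : ∑ i ∈ range p, f ((j : ℤ) + ((q * p + i : ℕ) : ℤ)) = ∑ i ∈ range p, f i := by
      have := sum_range_add_of_periodic hf (j + q * p)
      rw [← this]
      refine sum_congr rfl fun i _ => ?_
      congr 1; push_cast; ring
    rw [h2]; push_cast; ring

/-- The layered set with uniform heights is the point set of `barlowPeriodicConfiguration`. -/
theorem layeredSet_uniform_eq_points {a hb : ℝ} (ha : a ≠ 0) (hh : hb ≠ 0) :
    {q : E3 | ∃ m i j : ℤ, q = (LinearIsometry.id : E3 →ₗᵢ[ℝ] E3)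
        (((i : ℝ) • triangularVec₁ a) + ((j : ℝ) • triangularVec₂ a) +
          ((haggLabel alternatingHagg m : ℝ) • barlowOffset a) + (((m : ℝ) * hb) • layerNormal 1))} =
      (barlowPeriodicConfiguration alternatingHagg ha hh two_ne_zero alternatingHagg_periodic).points := by
  rw [barlowPeriodicConfiguration_points]
  ext q
  rw [mem_barlowStacking_iff]
  simp only [Set.mem_setOf_eq, LinearIsometry.coe_id, id_eq]
  constructor
  · rintro ⟨m, i, j, rfl⟩
    refine ⟨m, i, j, ?_⟩
    rw [barlowPos, pgl_layerNormal_eq_smul hb, smul_smul]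
  · rintro ⟨m, i, j, rfl⟩
    refine ⟨m, i, j, ?_⟩
    rw [barlowPos, pgl_layerNormal_eq_smul hb, smul_smul]

/-- Transport of a punctured point-set sum along a set equality. -/
theorem tsum_subtype_congr_set {S₁ S₂ : Set E3} (h : S₁ = S₂) (x : E3) (f : E3 → ℝ) :
    (∑' q : {q : E3 // q ∈ S₁ ∧ q ≠ x}, f q) = ∑' q : {q : E3 // q ∈ S₂ ∧ q ≠ x}, f q := by
  subst h; rfl

/-! ## Identification of the uniform alternating stack with `barlowPeriodicConfiguration` -/

/-- Per-layer identification at uniform heights `u n = n * hb`: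
`2 · barlowSiteEnergy m = Φ₀ + Tz a u m`. -/
theorem two_mul_barlowSiteEnergy_eq_cake {a hb : ℝ} (ha : 47 / 50 ≤ a) (ha1 : a ≤ 1)
    (hlo : 39 / 50 * a ≤ hb) (hhi : hb ≤ 17 / 20 * a) (m : ℤ) :
    2 * barlowSiteEnergy lennardJones a hb alternatingHagg m =
      inLayerInteraction lennardJones a + Tz a (fun n : ℤ => (n : ℝ) * hb) m := by
  have ha0 : 0 < a := by linarith
  have hb0 : 0 < hb := by linarith
  -- the layer cake of the landed `stub_layerCake`, clause 3, for the uniform data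
  obtain ⟨C, hcake⟩ := stub_layerCake
  obtain ⟨-, hrest⟩ := hcake a ha ha1
  have hzu : ∀ n : ℤ, 39 / 50 * a ≤ (((n + 1 : ℤ) : ℝ) * hb) - (n : ℝ) * hb ∧
      (((n + 1 : ℤ) : ℝ) * hb) - (n : ℝ) * hb ≤ 17 / 20 * a := by
    intro n; push_cast; constructor <;> nlinarith
  have h3 := (hrest (LinearIsometry.id : E3 →ₗᵢ[ℝ] E3) alternatingHagg (fun n : ℤ => (n : ℝ) * hb)
    isHaggSeq_alternating hzu).2.2.1 m 0 0
  -- the same punctured sum, written over the points of the periodic Barlow configuration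
  have hpt : (LinearIsometry.id : E3 →ₗᵢ[ℝ] E3) ((((0 : ℤ) : ℝ) • triangularVec₁ a) +
      (((0 : ℤ) : ℝ) • triangularVec₂ a) + ((haggLabel alternatingHagg m : ℝ) • barlowOffset a) +
      (((m : ℝ) * hb) • layerNormal 1)) = barlowPos a hb alternatingHagg m 0 0 := by
    rw [LinearIsometry.coe_id, id_eq, barlowPos, pgl_layerNormal_eq_smul hb, smul_smul]
  rw [hpt] at h3
  rw [tsum_subtype_congr_set (layeredSet_uniform_eq_points ha0.ne' hb0.ne') _
    (fun q : E3 => lennardJones (dist (barlowPos a hb alternatingHagg m 0 0) q))] at h3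
  rw [tsum_points_eq_two_mul_barlowSiteEnergy ha0 hb0 ha0.ne' hb0.ne' two_ne_zero
    alternatingHagg_periodic m] at h3
  rw [h3]
  unfold Tz
  rfl

/-- The hcp site energy does not depend on the layer. -/
theorem barlowSiteEnergy_alt_const {a hb : ℝ} (ha : 0 < a) (hh : 0 < hb) (m : ℤ) :
    barlowSiteEnergy lennardJones a hb alternatingHagg m =
      barlowSiteEnergy lennardJones a hb alternatingHagg 0 := by
  have hA := summable_layerInteraction_lennardJones ha hh 0
  have hN := summable_layerInteraction_lennardJones ha hh 1
  rw [barlowSiteEnergy_eq lennardJones a hb isHaggSeq_alternating hA hN m,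
    barlowSiteEnergy_eq lennardJones a hb isHaggSeq_alternating hA hN 0,
    clo_haggBackwardLocalEnergy_alternating, clo_haggBackwardLocalEnergy_alternating,
    haggLocalEnergy_alternating, haggLocalEnergy_alternating]

/-- Energy per particle of hcp = the site energy of layer `0`. -/
theorem energyPerParticle_hcp_eq_site {a hb : ℝ} (ha : 0 < a) (hh : 0 < hb) (ha' : a ≠ 0) (hh' : hb ≠ 0) :
    (barlowPeriodicConfiguration alternatingHagg ha' hh' two_ne_zero
        alternatingHagg_periodic).energyPerParticle lennardJones =
      barlowSiteEnergy lennardJones a hb alternatingHagg 0 := by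
  rw [energyPerParticle_barlow_eq_average ha hh ha' hh' two_ne_zero alternatingHagg_periodic]
  rw [Finset.sum_range_succ, Finset.sum_range_succ, Finset.sum_range_zero]
  push_cast
  rw [barlowSiteEnergy_alt_const ha hh 1]
  ring

/-! ## Jensen for midpoint-convex functions (Cauchy induction) -/

section Jensen

variable {X : Type*} [AddCommGroup X] [Module ℝ X]

/-- Dyadic Jensen step for a midpoint-convex function on a convex set (Cauchy forward induction). [folklore] -/
theorem jensen_pow_two (K : Set X) (hK : Convex ℝ K) (F : X → ℝ)
    (hF : ∀ x ∈ K, ∀ y ∈ K, F ((2 : ℝ)⁻¹ • (x + y)) ≤ (F x + F y) / 2) :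
    ∀ (t : ℕ) (x : ℕ → X), (∀ k, k < 2 ^ t → x k ∈ K) →
      ((2 ^ t : ℝ)⁻¹ • ∑ k ∈ range (2 ^ t), x k) ∈ K ∧
      F (((2 ^ t : ℝ))⁻¹ • ∑ k ∈ range (2 ^ t), x k) ≤ ((2 ^ t : ℝ))⁻¹ * ∑ k ∈ range (2 ^ t), F (x k) := by
  intro t
  induction t with
  | zero =>
    intro x hx
    simp only [pow_zero, inv_one, one_smul, range_one, sum_singleton, one_mul]
    exact ⟨hx 0 (by norm_num), le_rfl⟩
  | succ t ih =>
    intro x hx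
    have h2t : 2 ^ (t + 1) = 2 ^ t + 2 ^ t := by ring
    have hx1 : ∀ k, k < 2 ^ t → x k ∈ K := fun k hk => hx k (by rw [h2t]; omega)
    have hx2 : ∀ k, k < 2 ^ t → x (2 ^ t + k) ∈ K := fun k hk => hx (2 ^ t + k) (by rw [h2t]; omega)
    obtain ⟨hm1, hF1⟩ := ih x hx1
    obtain ⟨hm2, hF2⟩ := ih (fun k => x (2 ^ t + k)) hx2
    have hsplit : ∑ k ∈ range (2 ^ (t + 1)), x k =
        ∑ k ∈ range (2 ^ t), x k + ∑ k ∈ range (2 ^ t), x (2 ^ t + k) := by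
      rw [h2t, sum_range_add]
    have hsplitF : ∑ k ∈ range (2 ^ (t + 1)), F (x k) =
        ∑ k ∈ range (2 ^ t), F (x k) + ∑ k ∈ range (2 ^ t), F (x (2 ^ t + k)) := by
      rw [h2t, sum_range_add]
    have hpow : ((2 : ℝ) ^ (t + 1))⁻¹ = (2 : ℝ)⁻¹ * ((2 : ℝ) ^ t)⁻¹ := by
      rw [pow_succ, mul_inv, mul_comm]
    have havg : ((2 : ℝ) ^ (t + 1))⁻¹ • ∑ k ∈ range (2 ^ (t + 1)), x k =
        (2 : ℝ)⁻¹ • ((((2 : ℝ) ^ t)⁻¹ • ∑ k ∈ range (2 ^ t), x k) +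
          (((2 : ℝ) ^ t)⁻¹ • ∑ k ∈ range (2 ^ t), x (2 ^ t + k))) := by
      rw [hsplit, hpow, mul_smul, smul_add]
    refine ⟨?_, ?_⟩
    · rw [havg, smul_add]
      have e : (2 : ℝ)⁻¹ • (((2 : ℝ) ^ t)⁻¹ • ∑ k ∈ range (2 ^ t), x k) +
          (2 : ℝ)⁻¹ • (((2 : ℝ) ^ t)⁻¹ • ∑ k ∈ range (2 ^ t), x (2 ^ t + k)) =
          (2 : ℝ)⁻¹ • (((2 : ℝ) ^ t)⁻¹ • ∑ k ∈ range (2 ^ t), x k) +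
          (1 - (2 : ℝ)⁻¹) • (((2 : ℝ) ^ t)⁻¹ • ∑ k ∈ range (2 ^ t), x (2 ^ t + k)) := by
        norm_num
      rw [e]
      exact hK hm1 hm2 (by norm_num) (by norm_num) (by norm_num)
    · rw [havg, hsplitF, hpow]
      calc F ((2 : ℝ)⁻¹ • ((((2 : ℝ) ^ t)⁻¹ • ∑ k ∈ range (2 ^ t), x k) +
              (((2 : ℝ) ^ t)⁻¹ • ∑ k ∈ range (2 ^ t), x (2 ^ t + k))))
          ≤ (F (((2 : ℝ) ^ t)⁻¹ • ∑ k ∈ range (2 ^ t), x k) +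
              F (((2 : ℝ) ^ t)⁻¹ • ∑ k ∈ range (2 ^ t), x (2 ^ t + k))) / 2 := hF _ hm1 _ hm2
        _ ≤ ((((2 : ℝ) ^ t)⁻¹ * ∑ k ∈ range (2 ^ t), F (x k)) +
              (((2 : ℝ) ^ t)⁻¹ * ∑ k ∈ range (2 ^ t), F (x (2 ^ t + k)))) / 2 := by
            gcongr
        _ = (2 : ℝ)⁻¹ * ((2 : ℝ) ^ t)⁻¹ *
              (∑ k ∈ range (2 ^ t), F (x k) + ∑ k ∈ range (2 ^ t), F (x (2 ^ t + k))) := by ring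

/-- **Jensen for midpoint-convex functions, equal weights** (Cauchy's backward step: pad with the mean). -/
theorem jensen_midpoint (K : Set X) (hK : Convex ℝ K) (F : X → ℝ)
    (hF : ∀ x ∈ K, ∀ y ∈ K, F ((2 : ℝ)⁻¹ • (x + y)) ≤ (F x + F y) / 2)
    (N : ℕ) (hN : 0 < N) (x : ℕ → X) (hx : ∀ k, k < N → x k ∈ K) :
    F ((N : ℝ)⁻¹ • ∑ k ∈ range N, x k) ≤ (N : ℝ)⁻¹ * ∑ k ∈ range N, F (x k) := by
  set xbar : X := (N : ℝ)⁻¹ • ∑ k ∈ range N, x k with hxbar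
  have hN0 : (N : ℝ) ≠ 0 := by exact_mod_cast hN.ne'
  have hNpos : (0 : ℝ) < N := by exact_mod_cast hN
  have hmean : xbar ∈ K := by
    have := hK.sum_mem (t := range N) (w := fun _ => (N : ℝ)⁻¹) (z := x)
      (fun _ _ => by positivity) (by
        rw [sum_const, card_range, nsmul_eq_mul, mul_inv_cancel₀ hN0]) (fun k hk => hx k (mem_range.1 hk))
    simpa [hxbar, smul_sum] using this
  set y : ℕ → X := fun k => if k < N then x k else xbar with hy
  have hyK : ∀ k, k < 2 ^ N → y k ∈ K := by
    intro k _
    by_cases hk : k < N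
    · simp only [hy, hk, if_true]; exact hx k hk
    · simp only [hy, hk, if_false]; exact hmean
  obtain ⟨-, hJ⟩ := jensen_pow_two K hK F hF N y hyK
  set M : ℕ := 2 ^ N - N with hM
  have hNle : N ≤ 2 ^ N := Nat.lt_two_pow_self.le
  have hsplit : 2 ^ N = N + M := by omega
  have hsumy : ∑ k ∈ range (2 ^ N), y k = ∑ k ∈ range N, x k + (M : ℝ) • xbar := by
    rw [hsplit, sum_range_add]
    congr 1
    · exact sum_congr rfl fun k hk => by simp [hy, mem_range.1 hk]
    · rw [show ∑ k ∈ range M, y (N + k) = ∑ k ∈ range M, xbar from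
        sum_congr rfl fun k _ => by simp [hy], sum_const, card_range, ← Nat.cast_smul_eq_nsmul ℝ]
  have hsumFy : ∑ k ∈ range (2 ^ N), F (y k) = ∑ k ∈ range N, F (x k) + (M : ℝ) * F xbar := by
    rw [hsplit, sum_range_add]
    congr 1
    · exact sum_congr rfl fun k hk => by simp [hy, mem_range.1 hk]
    · rw [show ∑ k ∈ range M, F (y (N + k)) = ∑ k ∈ range M, F xbar from
        sum_congr rfl fun k _ => by simp [hy], sum_const, card_range, nsmul_eq_mul]
  have hpow0 : ((2 : ℝ) ^ N) ≠ 0 := by positivity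
  have hNM : (N : ℝ) + M = (2 : ℝ) ^ N := by
    have : ((2 ^ N : ℕ) : ℝ) = ((N + M : ℕ) : ℝ) := by rw [hsplit]
    push_cast at this; linarith
  have hmeany : ((2 : ℝ) ^ N)⁻¹ • ∑ k ∈ range (2 ^ N), y k = xbar := by
    rw [hsumy]
    have e1 : ∑ k ∈ range N, x k = (N : ℝ) • xbar := by
      rw [hxbar, smul_smul, mul_inv_cancel₀ hN0, one_smul]
    rw [e1, ← add_smul, hNM, smul_smul, inv_mul_cancel₀ hpow0, one_smul]
  have hJ' : F xbar ≤ ((2 : ℝ) ^ N)⁻¹ * (∑ k ∈ range N, F (x k) + (M : ℝ) * F xbar) := by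
    have := hJ
    rwa [hmeany, hsumFy] at this
  have key : (2 : ℝ) ^ N * F xbar ≤ ∑ k ∈ range N, F (x k) + (M : ℝ) * F xbar := by
    have := mul_le_mul_of_nonneg_left hJ' (le_of_lt (by positivity : (0 : ℝ) < 2 ^ N))
    rwa [← mul_assoc, mul_inv_cancel₀ hpow0, one_mul] at this
  have key2 : (N : ℝ) * F xbar ≤ ∑ k ∈ range N, F (x k) := by
    have key' : ((N : ℝ) + M) * F xbar ≤ ∑ k ∈ range N, F (x k) + (M : ℝ) * F xbar := by
      rw [hNM]; exact key
    rw [add_mul] at key'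
    linarith
  calc F xbar = (N : ℝ)⁻¹ * ((N : ℝ) * F xbar) := by field_simp
    _ ≤ (N : ℝ)⁻¹ * ∑ k ∈ range N, F (x k) := by gcongr

end Jensen

/-! ## The spacing side: `stub_uniformBarlowFloor` -/

/-- Telescoping over the shifts. -/
theorem tele (z : ℤ → ℝ) (l : ℤ) :
    ∀ p : ℕ, ∑ j ∈ range p, (z ((j : ℤ) + l + 1) - z ((j : ℤ) + l)) = z ((p : ℤ) + l) - z l := by
  intro p
  induction p with
  | zero => simp
  | succ p ih =>
    rw [sum_range_succ, ih]
    have e : ((p + 1 : ℕ) : ℤ) + l = (p : ℤ) + l + 1 := by push_cast; ring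
    rw [e]; ring

/-- The alternating block energy of `stub_convexity` / `clo_block_decomposition`. -/
def Fblk (a : ℝ) (n : ℕ) (Δ : ℕ → ℝ) : ℝ :=
  ∑ i ∈ Finset.range n, ∑ j ∈ Finset.Ioc i n, layerInteraction lennardJones a
    (∑ l ∈ Finset.Ico i j, Δ l) (if Even (j - i) then 0 else 1) 1

/-- **Uniform Barlow floor** (stub `stub_uniformBarlowFloor` of line `layered-seam`, proved): for
`a ∈ [47/50, 1]` and heights with `p`-periodic increments in `[39a/50, 17a/20]`, the hcp-type uniform stacking
at the MEAN increment `h̄ ∈ [39a/50, 17a/20]` satisfies `2p · e(hcp a h̄) ≤ Σ_{m<p} (Φ₀(a) + T_alt(m))`.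
Jensen (Cauchy induction) on the certified midpoint convexity `LayeredHull.stub_convexity` of the alternating
block energies, blocks of `q` periods via `LayeredHull.clo_block_decomposition` (boundary error `16 C`,
killed by `q → ∞`), identification via `BarlowEnergyIdentification`. [folklore] -/
theorem uniformBarlowFloor :
    ∀ a : ℝ, 47 / 50 ≤ a → a ≤ 1 → ∀ (z : ℤ → ℝ) (p : ℕ), 0 < p →
      (∀ m : ℤ, z (m + p + 1) - z (m + p) = z (m + 1) - z m) →
      (∀ m : ℤ, 39 / 50 * a ≤ z (m + 1) - z m ∧ z (m + 1) - z m ≤ 17 / 20 * a) →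
      ∃ h : ℝ, 39 / 50 * a ≤ h ∧ h ≤ 17 / 20 * a ∧ ∃ (ha : a ≠ 0) (hh : h ≠ 0),
        2 * (p : ℝ) *
            (Literature.MathematicalPhysics.StatisticalMechanics.barlowPeriodicConfiguration
                Literature.MathematicalPhysics.StatisticalMechanics.alternatingHagg ha hh (two_ne_zero)
                Literature.MathematicalPhysics.StatisticalMechanics.alternatingHagg_periodic).energyPerParticle
              Literature.MathematicalPhysics.StatisticalMechanics.lennardJones ≤
          ∑ m ∈ Finset.range p,
            (Literature.MathematicalPhysics.StatisticalMechanics.inLayerInteraction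
                Literature.MathematicalPhysics.StatisticalMechanics.lennardJones a +
              ∑' m' : ℤ, if m' = (m : ℤ) then (0 : ℝ) else
                Literature.MathematicalPhysics.StatisticalMechanics.layerInteraction
                  Literature.MathematicalPhysics.StatisticalMechanics.lennardJones a (z m' - z m)
                  (Literature.MathematicalPhysics.StatisticalMechanics.haggLabel
                      Literature.MathematicalPhysics.StatisticalMechanics.alternatingHagg m' -
                    Literature.MathematicalPhysics.StatisticalMechanics.haggLabel
                      Literature.MathematicalPhysics.StatisticalMechanics.alternatingHagg m) 1) := by
  intro a ha ha1 z p hp hzp hz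
  have ha0 : 0 < a := by linarith
  have hp0 : (0 : ℝ) < p := by exact_mod_cast hp
  set lo : ℝ := 39 / 50 * a with hlo_def
  set hi : ℝ := 17 / 20 * a with hhi_def
  -- Step 1: the mean increment lies in the box
  set hb : ℝ := (z p - z 0) / p with hhb
  have htel : z (p : ℤ) - z 0 = ∑ j ∈ range p, (z ((j : ℤ) + 0 + 1) - z ((j : ℤ) + 0)) := by
    rw [tele z 0 p]; simp
  have hsum_lo : (p : ℝ) * lo ≤ z (p : ℤ) - z 0 := by
    rw [htel]
    have : ∑ j ∈ range p, lo ≤ ∑ j ∈ range p, (z ((j : ℤ) + 0 + 1) - z ((j : ℤ) + 0)) :=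
      sum_le_sum fun j _ => (hz ((j : ℤ) + 0)).1
    rwa [sum_const, card_range, nsmul_eq_mul] at this
  have hsum_hi : z (p : ℤ) - z 0 ≤ (p : ℝ) * hi := by
    rw [htel]
    have : ∑ j ∈ range p, (z ((j : ℤ) + 0 + 1) - z ((j : ℤ) + 0)) ≤ ∑ j ∈ range p, hi :=
      sum_le_sum fun j _ => (hz ((j : ℤ) + 0)).2
    rwa [sum_const, card_range, nsmul_eq_mul] at this
  have hblo : lo ≤ hb := by rw [hhb, le_div_iff₀ hp0]; linarith
  have hbhi : hb ≤ hi := by rw [hhb, div_le_iff₀ hp0]; linarith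
  have hb0 : 0 < hb := lt_of_lt_of_le (by rw [hlo_def]; linarith) hblo
  refine ⟨hb, hblo, hbhi, ha0.ne', hb0.ne', ?_⟩
  -- the uniform data
  set u : ℤ → ℝ := fun n => (n : ℝ) * hb with hu
  have hzu : ∀ m : ℤ, 39 / 50 * a ≤ u (m + 1) - u m ∧ u (m + 1) - u m ≤ 17 / 20 * a := by
    intro m; simp only [hu]; push_cast; constructor <;> nlinarith
  have hup : ∀ m : ℤ, u (m + p + 1) - u (m + p) = u (m + 1) - u m := by
    intro m; simp only [hu]; push_cast; ring
  -- Step 2: identification of the left-hand side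
  rw [energyPerParticle_hcp_eq_site ha0 hb0]
  have hid : ∀ m : ℤ, 2 * barlowSiteEnergy lennardJones a hb alternatingHagg 0 =
      inLayerInteraction lennardJones a + Tz a u m := by
    intro m
    rw [← barlowSiteEnergy_alt_const ha0 hb0 m]
    exact two_mul_barlowSiteEnergy_eq_cake ha ha1 hblo hbhi m
  have hL : 2 * (p : ℝ) * barlowSiteEnergy lennardJones a hb alternatingHagg 0 =
      ∑ m ∈ range p, (inLayerInteraction lennardJones a + Tz a u m) := by
    rw [show ∑ m ∈ range p, (inLayerInteraction lennardJones a + Tz a u m) =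
        ∑ m ∈ range p, (2 * barlowSiteEnergy lennardJones a hb alternatingHagg 0) from
      sum_congr rfl fun m _ => (hid m).symm, sum_const, card_range, nsmul_eq_mul]
    ring
  rw [hL]
  -- the goal is now a comparison of the two period sums
  show ∑ m ∈ range p, (inLayerInteraction lennardJones a + Tz a u m) ≤
      ∑ m ∈ range p, (inLayerInteraction lennardJones a + Tz a z m)
  rw [sum_add_distrib, sum_add_distrib]
  gcongr ?_ + ?_
  · exact le_rfl
  -- Step 3: `Su ≤ Sz` by blocks, Jensen and the certified convexity
  set Sz : ℝ := ∑ m ∈ range p, Tz a z m with hSz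
  set Su : ℝ := ∑ m ∈ range p, Tz a u m with hSu
  show Su ≤ Sz
  obtain ⟨κ, hκ, hconv⟩ := stub_convexity
  obtain ⟨C, hcake⟩ := stub_layerCake
  obtain ⟨hdecay, hrest⟩ := hcake a ha ha1
  have hsum_z := (hrest (LinearIsometry.id : E3 →ₗᵢ[ℝ] E3) alternatingHagg z isHaggSeq_alternating hz).2.1
  have hsum_u := (hrest (LinearIsometry.id : E3 →ₗᵢ[ℝ] E3) alternatingHagg u isHaggSeq_alternating hzu).2.1
  have hTz : ∀ m : ℤ, Tz a z (m + p) = Tz a z m := Tz_periodic a z p hzp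
  have hTu : ∀ m : ℤ, Tz a u (m + p) = Tz a u m := Tz_periodic a u p hup
  -- block bound for data `w` with `p`-periodic `Tz`, base `j`
  have hblock : ∀ (w : ℤ → ℝ), (∀ m : ℤ, 39 / 50 * a ≤ w (m + 1) - w m ∧ w (m + 1) - w m ≤ 17 / 20 * a) →
      (∀ m : ℤ, Summable fun m' : ℤ => if m' = m then (0 : ℝ) else
        layerInteraction lennardJones a (w m' - w m) (haggLabel alternatingHagg m' - haggLabel alternatingHagg m) 1) →
      (∀ m : ℤ, Tz a w (m + p) = Tz a w m) →
      ∀ (j q n : ℕ), n + 1 = q * p →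
        |(q : ℝ) * (∑ m ∈ range p, Tz a w m) - 2 * Fblk a n (fun l => w ((j : ℤ) + l + 1) - w ((j : ℤ) + l))| ≤
          16 * C := by
    intro w hw hsw hTw j q n hn
    have hbd := clo_block_decomposition ha isHaggSeq_alternating alt_succ hw hdecay hsw (j : ℤ) n
    have hper : ∑ m ∈ Finset.Ico (j : ℤ) ((j : ℤ) + ((n + 1 : ℕ) : ℤ)), Tz a w m =
        (q : ℝ) * ∑ m ∈ range p, Tz a w m := by
      rw [clo_sum_Ico_eq_sum_range, hn]
      exact sum_range_mul_of_periodic hTw j q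
    rw [← hper]
    exact hbd
  have main : ∀ q : ℕ, 0 < q → (q : ℝ) * (Su - Sz) ≤ 32 * C := by
    intro q hq
    obtain ⟨n, hn⟩ : ∃ n : ℕ, n + 1 = q * p :=
      ⟨q * p - 1, by have : 0 < q * p := Nat.mul_pos hq hp; omega⟩
    -- the box and its convexity
    set K : Set (ℕ → ℝ) := {Δ | ∀ i : ℕ, i < n → lo ≤ Δ i ∧ Δ i ≤ hi} with hK
    have hKc : Convex ℝ K := by
      intro x hx y hy c d hc hd hcd i hi'
      have h1 := hx i hi'; have h2 := hy i hi'
      simp only [Pi.add_apply, Pi.smul_apply, smul_eq_mul]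
      constructor
      · calc lo = c * lo + d * lo := by rw [← add_mul, hcd, one_mul]
          _ ≤ c * x i + d * y i := add_le_add (mul_le_mul_of_nonneg_left h1.1 hc)
              (mul_le_mul_of_nonneg_left h2.1 hd)
      · calc c * x i + d * y i ≤ c * hi + d * hi := add_le_add (mul_le_mul_of_nonneg_left h1.2 hc)
              (mul_le_mul_of_nonneg_left h2.2 hd)
          _ = hi := by rw [← add_mul, hcd, one_mul]
    -- midpoint convexity of the block energy (certified, `stub_convexity`)
    have hF : ∀ x ∈ K, ∀ y ∈ K, Fblk a n ((2 : ℝ)⁻¹ • (x + y)) ≤ (Fblk a n x + Fblk a n y) / 2 := by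
      intro x hx y hy
      have hmid : (2 : ℝ)⁻¹ • (x + y) = fun l => (x l + y l) / 2 := by
        funext l; simp only [Pi.smul_apply, Pi.add_apply, smul_eq_mul]; ring
      have hc := hconv a ha ha1 n x y (fun i hi' => hx i hi') (fun i hi' => hy i hi')
      have hsq : 0 ≤ κ * ∑ i ∈ range n, (x i - y i) ^ 2 :=
        mul_nonneg hκ.le (sum_nonneg fun i _ => sq_nonneg _)
      rw [hmid]
      unfold Fblk
      linarith
    -- the shifts of the increments of `z` and their mean
    set D : ℕ → (ℕ → ℝ) := fun j l => z ((j : ℤ) + l + 1) - z ((j : ℤ) + l) with hD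
    have hDK : ∀ j : ℕ, j < p → D j ∈ K := by
      intro j _ i _
      exact hz ((j : ℤ) + i)
    have hmean : (p : ℝ)⁻¹ • ∑ j ∈ range p, D j = fun _ => hb := by
      funext l
      simp only [hD, Pi.smul_apply, Finset.sum_apply, smul_eq_mul]
      rw [tele z (l : ℤ) p]
      have hc := incr_const z p hzp (l : ℤ)
      rw [add_comm] at hc
      rw [hc, hhb]
      field_simp
    have hJ := jensen_midpoint K hKc (Fblk a n) hF p hp D hDK
    rw [hmean] at hJ
    -- block bounds
    have hBz : ∀ j : ℕ, 2 * Fblk a n (D j) ≤ (q : ℝ) * Sz + 16 * C := by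
      intro j
      have := hblock z hz hsum_z hTz j q n hn
      rw [abs_le] at this
      simp only [hD]
      linarith [this.1]
    have hBu : (q : ℝ) * Su - 16 * C ≤ 2 * Fblk a n (fun _ => hb) := by
      have := hblock u hzu hsum_u hTu 0 q n hn
      have e : (fun l : ℕ => u (((0 : ℕ) : ℤ) + l + 1) - u (((0 : ℕ) : ℤ) + l)) = fun _ => hb := by
        funext l; simp only [hu]; push_cast; ring
      rw [e, abs_le] at this
      linarith [this.2]
    -- chain
    have h2 : 2 * Fblk a n (fun _ => hb) ≤ (q : ℝ) * Sz + 16 * C := by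
      have hsum : ∑ j ∈ range p, Fblk a n (D j) ≤ ∑ j ∈ range p, (((q : ℝ) * Sz + 16 * C) / 2) :=
        sum_le_sum fun j _ => by linarith [hBz j]
      rw [sum_const, card_range, nsmul_eq_mul] at hsum
      have h3 : (p : ℝ)⁻¹ * ∑ k ∈ range p, Fblk a n (D k) ≤ ((q : ℝ) * Sz + 16 * C) / 2 := by
        calc (p : ℝ)⁻¹ * ∑ k ∈ range p, Fblk a n (D k)
            ≤ (p : ℝ)⁻¹ * ((p : ℝ) * (((q : ℝ) * Sz + 16 * C) / 2)) := by gcongr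
          _ = ((q : ℝ) * Sz + 16 * C) / 2 := by field_simp
      linarith [hJ]
    nlinarith [hBu, h2]
  -- Archimedes
  by_contra hlt
  have hlt' : Sz < Su := not_le.1 hlt
  have hd : 0 < Su - Sz := by linarith
  obtain ⟨q, hq⟩ := exists_nat_gt (32 * C / (Su - Sz))
  have hq1 := main (q + 1) (Nat.succ_pos q)
  have : 32 * C / (Su - Sz) < ((q + 1 : ℕ) : ℝ) := by push_cast; linarith
  rw [div_lt_iff₀ hd] at this
  linarith

/-! ## The word side -/

/-- **Restacking (word side)** — restacking to the alternating word at the same heights never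
raises a layer energy.**  For `a ∈ [47/50, 1]`, any Hägg word `s`, any heights `z` with increments in
`[39a/50, 17a/20]` and every layer `m`: `T_alt(m) ≤ T_s(m)`.  The `c₀ = 0` shadow of the landed
`LayeredHull.clo_layer_price`, whose hypotheses are discharged by the landed certified `LayeredHull.stub_registry`
and by `LayeredHull.stub_layerCake` (decay; summability via its clause 2 with `A = id`). [folklore] -/
theorem restackAlternating :
    ∀ a : ℝ, 47 / 50 ≤ a → a ≤ 1 → ∀ (s : ℤ → ℤ) (z : ℤ → ℝ),
      Literature.MathematicalPhysics.StatisticalMechanics.IsHaggSeq s →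
      (∀ m : ℤ, 39 / 50 * a ≤ z (m + 1) - z m ∧ z (m + 1) - z m ≤ 17 / 20 * a) →
      ∀ m : ℤ,
        (∑' m' : ℤ, if m' = m then (0 : ℝ) else
            Literature.MathematicalPhysics.StatisticalMechanics.layerInteraction
              Literature.MathematicalPhysics.StatisticalMechanics.lennardJones a (z m' - z m)
              (Literature.MathematicalPhysics.StatisticalMechanics.haggLabel
                  Literature.MathematicalPhysics.StatisticalMechanics.alternatingHagg m' -
                Literature.MathematicalPhysics.StatisticalMechanics.haggLabel
                  Literature.MathematicalPhysics.StatisticalMechanics.alternatingHagg m) 1) ≤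
        (∑' m' : ℤ, if m' = m then (0 : ℝ) else
            Literature.MathematicalPhysics.StatisticalMechanics.layerInteraction
              Literature.MathematicalPhysics.StatisticalMechanics.lennardJones a (z m' - z m)
              (Literature.MathematicalPhysics.StatisticalMechanics.haggLabel s m' -
                Literature.MathematicalPhysics.StatisticalMechanics.haggLabel s m) 1) := by
  intro a ha ha1 s z hs hz m
  obtain ⟨c₀, hc₀, hreg⟩ := stub_registry
  obtain ⟨hreg1, hreg2⟩ := hreg a ha ha1
  obtain ⟨C, hcake⟩ := stub_layerCake
  obtain ⟨hdecay, hrest⟩ := hcake a ha ha1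
  have hS := hrest (LinearIsometry.id : EuclideanSpace ℝ (Fin 3) →ₗᵢ[ℝ] EuclideanSpace ℝ (Fin 3)) s z hs hz
  have hA := hrest (LinearIsometry.id : EuclideanSpace ℝ (Fin 3) →ₗᵢ[ℝ] EuclideanSpace ℝ (Fin 3))
    alternatingHagg z isHaggSeq_alternating hz
  have key := clo_layer_price ha hs hz hdecay hreg1 hreg2 m (hS.2.1 m) (hA.2.1 m)
  have h0 : (0 : ℝ) ≤ c₀ * (if s (m + 1) = -s m then (0 : ℝ) else 1) := by
    have : (0 : ℝ) ≤ (if s (m + 1) = -s m then (0 : ℝ) else 1) := by split_ifs <;> norm_num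
    exact mul_nonneg hc₀.le this
  linarith

/-! ## Assembly and the reduction theorem -/

/-- **Assembly of the line**: layering → restacking → uniform floor → the crux.  Given `Q`, take the layered competitor of stub 1,
restack it to the alternating word layer by layer (stub 2), uniformise its spacings and identify the result
with `barlowPeriodicConfiguration alternatingHagg` at `(a, h̄) ∈ B` (stub 3); divide by `2p > 0`.
Concludes `MinMeanCycleStackingLock.PeriodicReductionToBarlow` BY NAME. -/
theorem PeriodicReductionToBarlow_of
    (hLayer : ∀ Q : Literature.MathematicalPhysics.StatisticalMechanics.PeriodicConfiguration 3,
      ∃ (a : ℝ) (s : ℤ → ℤ) (z : ℤ → ℝ) (p : ℕ), 0 < p ∧ 47 / 50 ≤ a ∧ a ≤ 1 ∧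
        Literature.MathematicalPhysics.StatisticalMechanics.IsHaggSeq s ∧ (∀ m : ℤ, s (m + p) = s m) ∧
        (∀ m : ℤ, z (m + p + 1) - z (m + p) = z (m + 1) - z m) ∧
        (∀ m : ℤ, 39 / 50 * a ≤ z (m + 1) - z m ∧ z (m + 1) - z m ≤ 17 / 20 * a) ∧
        (∑ m ∈ Finset.range p,
            (Literature.MathematicalPhysics.StatisticalMechanics.inLayerInteraction
                Literature.MathematicalPhysics.StatisticalMechanics.lennardJones a +
              ∑' m' : ℤ, if m' = (m : ℤ) then (0 : ℝ) else
                Literature.MathematicalPhysics.StatisticalMechanics.layerInteraction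
                  Literature.MathematicalPhysics.StatisticalMechanics.lennardJones a (z m' - z m)
                  (Literature.MathematicalPhysics.StatisticalMechanics.haggLabel s m' -
                    Literature.MathematicalPhysics.StatisticalMechanics.haggLabel s m) 1)) ≤
          2 * (p : ℝ) * Q.energyPerParticle Literature.MathematicalPhysics.StatisticalMechanics.lennardJones)
    (hRestack : ∀ a : ℝ, 47 / 50 ≤ a → a ≤ 1 → ∀ (s : ℤ → ℤ) (z : ℤ → ℝ),
      Literature.MathematicalPhysics.StatisticalMechanics.IsHaggSeq s →
      (∀ m : ℤ, 39 / 50 * a ≤ z (m + 1) - z m ∧ z (m + 1) - z m ≤ 17 / 20 * a) →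
      ∀ m : ℤ,
        (∑' m' : ℤ, if m' = m then (0 : ℝ) else
            Literature.MathematicalPhysics.StatisticalMechanics.layerInteraction
              Literature.MathematicalPhysics.StatisticalMechanics.lennardJones a (z m' - z m)
              (Literature.MathematicalPhysics.StatisticalMechanics.haggLabel
                  Literature.MathematicalPhysics.StatisticalMechanics.alternatingHagg m' -
                Literature.MathematicalPhysics.StatisticalMechanics.haggLabel
                  Literature.MathematicalPhysics.StatisticalMechanics.alternatingHagg m) 1) ≤
        (∑' m' : ℤ, if m' = m then (0 : ℝ) else
            Literature.MathematicalPhysics.StatisticalMechanics.layerInteraction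
              Literature.MathematicalPhysics.StatisticalMechanics.lennardJones a (z m' - z m)
              (Literature.MathematicalPhysics.StatisticalMechanics.haggLabel s m' -
                Literature.MathematicalPhysics.StatisticalMechanics.haggLabel s m) 1))
    (hFloor : ∀ a : ℝ, 47 / 50 ≤ a → a ≤ 1 → ∀ (z : ℤ → ℝ) (p : ℕ), 0 < p →
      (∀ m : ℤ, z (m + p + 1) - z (m + p) = z (m + 1) - z m) →
      (∀ m : ℤ, 39 / 50 * a ≤ z (m + 1) - z m ∧ z (m + 1) - z m ≤ 17 / 20 * a) →
      ∃ h : ℝ, 39 / 50 * a ≤ h ∧ h ≤ 17 / 20 * a ∧ ∃ (ha : a ≠ 0) (hh : h ≠ 0),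
        2 * (p : ℝ) *
            (Literature.MathematicalPhysics.StatisticalMechanics.barlowPeriodicConfiguration
                Literature.MathematicalPhysics.StatisticalMechanics.alternatingHagg ha hh (two_ne_zero)
                Literature.MathematicalPhysics.StatisticalMechanics.alternatingHagg_periodic).energyPerParticle
              Literature.MathematicalPhysics.StatisticalMechanics.lennardJones ≤
          ∑ m ∈ Finset.range p,
            (Literature.MathematicalPhysics.StatisticalMechanics.inLayerInteraction
                Literature.MathematicalPhysics.StatisticalMechanics.lennardJones a +
              ∑' m' : ℤ, if m' = (m : ℤ) then (0 : ℝ) else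
                Literature.MathematicalPhysics.StatisticalMechanics.layerInteraction
                  Literature.MathematicalPhysics.StatisticalMechanics.lennardJones a (z m' - z m)
                  (Literature.MathematicalPhysics.StatisticalMechanics.haggLabel
                      Literature.MathematicalPhysics.StatisticalMechanics.alternatingHagg m' -
                    Literature.MathematicalPhysics.StatisticalMechanics.haggLabel
                      Literature.MathematicalPhysics.StatisticalMechanics.alternatingHagg m) 1)) :
    Summit.AtomisticToContinuum.Crystallization.Theses.MinMeanCycleStackingLock.PeriodicReductionToBarlow := by
  intro Q
  obtain ⟨a, s, z, p, hp, ha₁, ha₂, hs, _hsp, hzp, hz, hE⟩ := hLayer Q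
  obtain ⟨h, hh₁, hh₂, ha, hh, hfloor⟩ := hFloor a ha₁ ha₂ z p hp hzp hz
  -- restacking, summed over a period
  have hsum :
      (∑ m ∈ Finset.range p,
          (Literature.MathematicalPhysics.StatisticalMechanics.inLayerInteraction
              Literature.MathematicalPhysics.StatisticalMechanics.lennardJones a +
            ∑' m' : ℤ, if m' = (m : ℤ) then (0 : ℝ) else
              Literature.MathematicalPhysics.StatisticalMechanics.layerInteraction
                Literature.MathematicalPhysics.StatisticalMechanics.lennardJones a (z m' - z m)
                (Literature.MathematicalPhysics.StatisticalMechanics.haggLabel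
                    Literature.MathematicalPhysics.StatisticalMechanics.alternatingHagg m' -
                  Literature.MathematicalPhysics.StatisticalMechanics.haggLabel
                    Literature.MathematicalPhysics.StatisticalMechanics.alternatingHagg m) 1)) ≤
      ∑ m ∈ Finset.range p,
          (Literature.MathematicalPhysics.StatisticalMechanics.inLayerInteraction
              Literature.MathematicalPhysics.StatisticalMechanics.lennardJones a +
            ∑' m' : ℤ, if m' = (m : ℤ) then (0 : ℝ) else
              Literature.MathematicalPhysics.StatisticalMechanics.layerInteraction
                Literature.MathematicalPhysics.StatisticalMechanics.lennardJones a (z m' - z m)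
                (Literature.MathematicalPhysics.StatisticalMechanics.haggLabel s m' -
                  Literature.MathematicalPhysics.StatisticalMechanics.haggLabel s m) 1) := by
    refine Finset.sum_le_sum fun m _ => ?_
    exact add_le_add le_rfl (hRestack a ha₁ ha₂ s z hs hz (m : ℤ))
  have hchain := (hfloor.trans hsum).trans hE
  have hp' : (0 : ℝ) < 2 * (p : ℝ) := by positivity
  have hle :
      (Literature.MathematicalPhysics.StatisticalMechanics.barlowPeriodicConfiguration
          Literature.MathematicalPhysics.StatisticalMechanics.alternatingHagg ha hh (two_ne_zero)
          Literature.MathematicalPhysics.StatisticalMechanics.alternatingHagg_periodic).energyPerParticle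
        Literature.MathematicalPhysics.StatisticalMechanics.lennardJones ≤
      Q.energyPerParticle Literature.MathematicalPhysics.StatisticalMechanics.lennardJones :=
    le_of_mul_le_mul_left hchain hp'
  refine ⟨a, h, ha₁, ha₂, hh₁, hh₂, Literature.MathematicalPhysics.StatisticalMechanics.alternatingHagg, 2,
    ha, hh, two_ne_zero, Literature.MathematicalPhysics.StatisticalMechanics.alternatingHagg_periodic,
    Literature.MathematicalPhysics.StatisticalMechanics.isHaggSeq_alternating, hle⟩

/-- **The reduction** (line `layered-seam` with its word side and spacing side discharged): if every
periodic configuration of `ℝ³` is matched, at no higher Lennard-Jones energy per particle, by some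
`p`-periodic LAYERED stacking in the box (triangular layers of spacing `a ∈ [47/50, 1]` in hole registry
along a `p`-periodic Hägg word, heights with `p`-periodic increments in `[39a/50, 17a/20]`, energy counted by
the layer cake `(2p)⁻¹ Σ_{m<p} (Φ₀(a) + T_s(m))`), then the crux `PeriodicReductionToBarlow` holds. -/
theorem PeriodicReductionToBarlow_of_periodicLayeringInBox
    (hLayer : ∀ Q : Literature.MathematicalPhysics.StatisticalMechanics.PeriodicConfiguration 3,
      ∃ (a : ℝ) (s : ℤ → ℤ) (z : ℤ → ℝ) (p : ℕ), 0 < p ∧ 47 / 50 ≤ a ∧ a ≤ 1 ∧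
        Literature.MathematicalPhysics.StatisticalMechanics.IsHaggSeq s ∧ (∀ m : ℤ, s (m + p) = s m) ∧
        (∀ m : ℤ, z (m + p + 1) - z (m + p) = z (m + 1) - z m) ∧
        (∀ m : ℤ, 39 / 50 * a ≤ z (m + 1) - z m ∧ z (m + 1) - z m ≤ 17 / 20 * a) ∧
        (∑ m ∈ Finset.range p,
            (Literature.MathematicalPhysics.StatisticalMechanics.inLayerInteraction
                Literature.MathematicalPhysics.StatisticalMechanics.lennardJones a +
              ∑' m' : ℤ, if m' = (m : ℤ) then (0 : ℝ) else
                Literature.MathematicalPhysics.StatisticalMechanics.layerInteraction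
                  Literature.MathematicalPhysics.StatisticalMechanics.lennardJones a (z m' - z m)
                  (Literature.MathematicalPhysics.StatisticalMechanics.haggLabel s m' -
                    Literature.MathematicalPhysics.StatisticalMechanics.haggLabel s m) 1)) ≤
          2 * (p : ℝ) * Q.energyPerParticle Literature.MathematicalPhysics.StatisticalMechanics.lennardJones) :
    Summit.AtomisticToContinuum.Crystallization.Theses.MinMeanCycleStackingLock.PeriodicReductionToBarlow :=
  PeriodicReductionToBarlow_of hLayer restackAlternating uniformBarlowFloor

/-- The `PoissonBesselStacking` copy of the shared item 3062 (identical signature), reduced likewise. -/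
theorem PeriodicReductionToBarlow_of_periodicLayeringInBox_PBS
    (hLayer : ∀ Q : Literature.MathematicalPhysics.StatisticalMechanics.PeriodicConfiguration 3,
      ∃ (a : ℝ) (s : ℤ → ℤ) (z : ℤ → ℝ) (p : ℕ), 0 < p ∧ 47 / 50 ≤ a ∧ a ≤ 1 ∧
        Literature.MathematicalPhysics.StatisticalMechanics.IsHaggSeq s ∧ (∀ m : ℤ, s (m + p) = s m) ∧
        (∀ m : ℤ, z (m + p + 1) - z (m + p) = z (m + 1) - z m) ∧
        (∀ m : ℤ, 39 / 50 * a ≤ z (m + 1) - z m ∧ z (m + 1) - z m ≤ 17 / 20 * a) ∧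
        (∑ m ∈ Finset.range p,
            (Literature.MathematicalPhysics.StatisticalMechanics.inLayerInteraction
                Literature.MathematicalPhysics.StatisticalMechanics.lennardJones a +
              ∑' m' : ℤ, if m' = (m : ℤ) then (0 : ℝ) else
                Literature.MathematicalPhysics.StatisticalMechanics.layerInteraction
                  Literature.MathematicalPhysics.StatisticalMechanics.lennardJones a (z m' - z m)
                  (Literature.MathematicalPhysics.StatisticalMechanics.haggLabel s m' -
                    Literature.MathematicalPhysics.StatisticalMechanics.haggLabel s m) 1)) ≤
          2 * (p : ℝ) * Q.energyPerParticle Literature.MathematicalPhysics.StatisticalMechanics.lennardJones) :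
    Summit.AtomisticToContinuum.Crystallization.Theses.PoissonBesselStacking.PeriodicReductionToBarlow :=
  PeriodicReductionToBarlow_of hLayer restackAlternating uniformBarlowFloor

/-- The `LuttingerTiszaRegistry` copy of the shared item 3062 (identical signature), reduced likewise. -/
theorem PeriodicReductionToBarlow_of_periodicLayeringInBox_LT
    (hLayer : ∀ Q : Literature.MathematicalPhysics.StatisticalMechanics.PeriodicConfiguration 3,
      ∃ (a : ℝ) (s : ℤ → ℤ) (z : ℤ → ℝ) (p : ℕ), 0 < p ∧ 47 / 50 ≤ a ∧ a ≤ 1 ∧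
        Literature.MathematicalPhysics.StatisticalMechanics.IsHaggSeq s ∧ (∀ m : ℤ, s (m + p) = s m) ∧
        (∀ m : ℤ, z (m + p + 1) - z (m + p) = z (m + 1) - z m) ∧
        (∀ m : ℤ, 39 / 50 * a ≤ z (m + 1) - z m ∧ z (m + 1) - z m ≤ 17 / 20 * a) ∧
        (∑ m ∈ Finset.range p,
            (Literature.MathematicalPhysics.StatisticalMechanics.inLayerInteraction
                Literature.MathematicalPhysics.StatisticalMechanics.lennardJones a +
              ∑' m' : ℤ, if m' = (m : ℤ) then (0 : ℝ) else
                Literature.MathematicalPhysics.StatisticalMechanics.layerInteraction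
                  Literature.MathematicalPhysics.StatisticalMechanics.lennardJones a (z m' - z m)
                  (Literature.MathematicalPhysics.StatisticalMechanics.haggLabel s m' -
                    Literature.MathematicalPhysics.StatisticalMechanics.haggLabel s m) 1)) ≤
          2 * (p : ℝ) * Q.energyPerParticle Literature.MathematicalPhysics.StatisticalMechanics.lennardJones) :
    Summit.AtomisticToContinuum.Crystallization.Theses.LuttingerTiszaRegistry.PeriodicReductionToBarlow :=
  PeriodicReductionToBarlow_of hLayer restackAlternating uniformBarlowFloor

end Summit.AtomisticToContinuum.Crystallization.Theorems.LayeredSeam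

end
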